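import Mathlib
import HarnessLib
import HarnessLib.Audit
import Summits.AtomisticToContinuum.Statement

/-!
Route: KnudsenRate

CLOSED (retired) 2026-08-15T13:43:41Z by operator:999:1257524 — reason: not-a-thesis: assembly does not conclude the sub-problem Statement — note: D-0027 §2.1 audit (human 2026-08-15: routes that do not decide the summit are removed): the assembly concludes `Literature.MathematicalPhysics.KineticTheory.HydrodynamicLimit`, not the sub-problem statement; a NEW conforming route may be opened from the same idea (generated `closes : … → _root_.Hydr. The file is kept as the record of this route; refuted decls are indexed as negative knowledge (`ledger negatives`).

# Route KnudsenRate — Quantify Yau at Knudsen rate: H_N = O(N^{2/3}) before the shock implies Euler;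
the N^{1/3}-rescaled entropy is Navier-Stokes dissipation; log N Ehrenfest horizon on the negative
side

X = EntropyKnudsenRate ("it suffices to show"): for all continuous local-equilibrium profiles (a₀,
u₀, θ₀) there is σ₀ > 0 such that for
every reduced density 0 < σ < σ₀, every classical hard-sphere Euler solution (ρ, u, θ) on [0, T),
every family of hard-sphere flows Φ_N and
every t < T there is a reference activity profile a (its local Gibbs law λ^N_t = localGibbsLaw σ a
u_t θ_t being a probability measure whose
empirical fields concentrate exponentially around (ρ, ρu, E)(t)) with the KNUDSEN-RATE entropy bound
    H( (Φ_N,t)_* localGibbsLaw σ a₀ u₀ θ₀ | λ^N_t ) ≤ C (N+1)^(2/3) = C · (N+1) · Kn_N,   Kn_N =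
(N+1)^(-1/3),
for all N. This is Yau's relative-entropy form of the hydrodynamic limit
(stmt-AtomisticToContinuum-0766, RelEntropyVanishing: H = o(N))
QUANTIFIED at the physically predicted order (Chapman–Enskog: the deviation from local Gibbs at
Euler parameters is the Navier–Stokes
correction, relative size Kn). It realises card knudsen-rate-law-and-ehrenfest-horizon (spine):
(Q1)/(Q5) = the target; law (1)/(Q2) = crux
KnudsenRateLaw; (2)/(Q3) = the negative-side crux EhrenfestHorizon; (3) "rates, not o(N), are the
induction currency" is why X and not 0766 is
the target. X is textually 0766 with `Tendsto (klDiv/(N+1)) → 0` replaced by `∃ C, ∀ N, klDiv ≤ C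
(N+1)^(2/3)`, so X → 0766 is one line.
Lean: `∀ (a₀ θ₀ : Literature.MathematicalPhysics.KineticTheory.T3 → ℝ) (u₀ :
Literature.MathematicalPhysics.KineticTheory.T3 → Literature.MathematicalPhysics.KineticTheory.V3),
Continuous a₀ → Continuous θ₀ → Continuous u₀ → (∀ x, 0 < a₀ x) → (∀ x, 0 < θ₀ x) → ∃ σ₀ : ℝ, 0 < σ₀
∧ ∀ σ : ℝ, 0 < σ → σ < σ₀ → ∀ (T : ℝ) (ρ θ : ℝ → Literature.MathematicalPhysics.KineticTheory.T3 →
ℝ) (u : ℝ → Literature.MathematicalPhysics.KineticTheory.T3 →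
Literature.MathematicalPhysics.KineticTheory.V3),
Literature.MathematicalPhysics.KineticTheory.IsHardSphereEulerSolution σ T ρ u θ → ∀ Φ : (N : ℕ) →
Literature.Analysis.FluidPDE.HardSphereFlow (Literature.Analysis.FluidPDE.Torus.geometry (Fin 3))
(Literature.MathematicalPhysics.KineticTheory.hsDiameter σ N) (N + 1), (∀ N,
MeasureTheory.IsProbabilityMeasure (Literature.MathematicalPhysics.KineticTheory.localGibbsLaw σ a₀
u₀ θ₀ N (Φ N))) ∧ (Literature.MathematicalPhysics.KineticTheory.TendstoHydroFieldsAt (fun N =>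
Literature.MathematicalPhysics.KineticTheory.localGibbsLaw σ a₀ u₀ θ₀ N (Φ N)) Φ ρ u θ 0 → ∀ t ∈
Set.Ico 0 T, ∃ a : Literature.MathematicalPhysics.KineticTheory.T3 → ℝ, (∀ N,
MeasureTheory.IsProbabilityMeasure (Literature.MathematicalPhysics.KineticTheory.localGibbsLaw σ a
(u t) (θ t) N (Φ N))) ∧ (∀ χ : Literature.MathematicalPhysics.KineticTheory.T3 → ℝ, Continuous χ → ∀
δ : ℝ, 0 < δ → ∃ C : ℝ, 0 < C ∧ ∀ N : ℕ, Literature.MathematicalPhysics.KineticTheory.localGibbsLaw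
σ a (u t) (θ t) N (Φ N) {z | δ < |Literature.MathematicalPhysics.KineticTheory.empiricalDensityField
z χ - ∫ x, χ x * ρ t x|} ≤ ENNReal.ofReal (C * Real.exp (-(C⁻¹ * (N + 1)))) ∧
Literature.MathematicalPhysics.KineticTheory.localGibbsLaw σ a (u t) (θ t) N (Φ N) {z | δ <
‖Literature.MathematicalPhysics.KineticTheory.empiricalMomentumField z χ - ∫ x, (χ x * ρ t x) • u t
x‖} ≤ ENNReal.ofReal (C * Real.exp (-(C⁻¹ * (N + 1)))) ∧
Literature.MathematicalPhysics.KineticTheory.localGibbsLaw σ a (u t) (θ t) N (Φ N) {z | δ <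
|Literature.MathematicalPhysics.KineticTheory.empiricalEnergyField z χ - ∫ x, χ x *
Literature.MathematicalPhysics.KineticTheory.totalEnergyDensity (ρ t x) (u t x) (θ t x)|} ≤
ENNReal.ofReal (C * Real.exp (-(C⁻¹ * (N + 1))))) ∧ ∃ C : ℝ, ∀ N : ℕ, InformationTheory.klDiv ((Φ
N).lawAt (Literature.MathematicalPhysics.KineticTheory.localGibbsLaw σ a₀ u₀ θ₀ N (Φ N)) t)
(Literature.MathematicalPhysics.KineticTheory.localGibbsLaw σ a (u t) (θ t) N (Φ N)) ≤
ENNReal.ofReal (C * ((N : ℝ) + 1) ^ (2 / 3 : ℝ)))`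

## Assembly
X → HydrodynamicLimit exactly as the filed assembly 0769 (RelEntropyVanishing → HydrodynamicLimit):
the entropy inequality
μ(A) ≤ (log 2 + H(μ|λ))/log(1 + 1/λ(A)) with λ(A) ≤ C e^(−(N+1)/C) (reference concentration) and H ≤
C(N+1)^(2/3) gives μ(A) ≤ C'(N+1)^(-1/3) → 0;
μ = lawAt Φ_N P_N t = P_N.map (flow t) turns μ{δ < |field z − ·|} into P_N{δ < |field(flow t z) −
·|}; σ₀ from X. Equivalently X → 0766 (klDiv/(N+1) ≤
C(N+1)^(-1/3) → 0 in ℝ≥0∞) and then 0769. The cruxes feed X through the foreseen glue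
KineticFluxRelaxation (+ collisional half) ⇒ Yau–Gronwall at
Knudsen precision ⇒ MeanFieldKnudsenAccuracy ⇒ (EntropySaturationKnudsen) X; KnudsenRateLaw sharpens
MeanFieldKnudsenAccuracy; EhrenfestHorizon is
the negative side and is not used.

Rationale: WHY THIS LINE. Every open route of this sub-problem aims at the QUALITATIVE target H_N(t) = o(N)
(0766) or at L² field convergence (0800); none states the
order of magnitude that kinetic theory predicts, H_N(t)/N ≍ Kn_N = N^{-1/3} (one mean free path ℓ =
(√2πσ²)^{-1} N^{-1/3} in macroscopic units,
Spohn1991 Part I Ch. 3; ChapmanCowling1970), and none can be tested against molecular dynamics. This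
line makes the rate the target: by the
exact entropy-saturation identity (Liouville invariance of Shannon entropy + log-linearity of
hard-sphere local Gibbs laws in the empirical
measure + isentropy of smooth Euler flow; card entropy-saturation-mean-closure, quantified here as
support EntropySaturationKnudsen),
H_N(t)/(N+1) equals ONE linear statistic Θ_N(t) of the expected empirical fields up to O(N^{-2/3}),
so X ⇔ "hydrodynamics holds IN THE MEAN to
Navier–Stokes precision" (crux MeanFieldKnudsenAccuracy), whose kinetic content is "fast
one-particle moments are in local equilibrium to
O(Kn)" (crux KineticFluxRelaxation), and whose sharp form is the second-order law N^{1/3}Θ_N(t) →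
∫₀ᵗ∫ [η|S(u)|²/2θ + ζ(div u)²/θ + κ|∇θ|²/θ²]
(crux KnudsenRateLaw: relative entropy now = Navier–Stokes entropy production of the Euler flow
later, in Knudsen units). Imported areas:
kinetic theory of moderately dense gases (Enskog/Green–Kubo transport, Dorfman1999,
EvansMorriss2008) for the constants; quantitative
hydrodynamic limits by consistency–stability (Menegaki–Mouhot arXiv:2212.00079, arXiv:2412.16714 —
rates for stochastic lattice gases) as the
model of a rate-first target; Navier–Stokes corrections to hydrodynamic limits (Esposito–Marra–Yau
doi:10.1007/bf02517896, De Masi–Esposito–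
Lebowitz doi:10.1002/cpa.3160420810) for the form of the law; hydrodynamic stability
(MeshalkinSinai1961, Belenkaya–Friedlander–Yudovich
doi:10.1137/s0036139997327575) and fluctuating hydrodynamics (Spohn1991 §7.1 (7.28);
thermal-noise-seeded instabilities in MD, Kadau et al.
doi:10.1073/pnas.0401228101; Bandak–Goldenfeld–Mailybaev–Eyink doi:10.1103/physreve.105.065113) for
the negative side. What it does that prior
routes do not: a polynomial rate self-iterates under Gronwall/restarts where o(N) does not, every
item is an MD-falsifiable number, and the
log N horizon says where ANY growing-time strengthening must fail although the Euler solution is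
global and smooth.

RANKED CRUXES. #0 EntropyKnudsenRate (target) — X as in § Thesis: the 0766-shaped statement with the
conclusion ∃ a (probability, exponential concentration of the reference fields around (ρ,ρu,E)(t)) ∧
∃ C ∀ N, klDiv(lawAt Φ_N (localGibbs a₀u₀θ₀) t ‖ localGibbs a u_t θ_t) ≤ C (N+1)^(2/3). Card items
(Q1)/(Q5). (why it might fail: Strictly stronger than the conjunct: if local equilibrium is reached
only at an anomalous algebraic rate slower than Kn = N^(-1/3) (e.g. N^(-1/6)), 0766 holds and X
fails; inherits the Boltzmann-hypothesis and large-velocity obstructions of 0766.) [Yau1991,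
OllaVaradhanYau1993, KipnisLandim1999, Spohn1991, arXiv:2212.00079]
#2 KineticFluxRelaxation (crux) — LOCAL EQUILIBRIUM OF THE FAST MOMENTS AT KNUDSEN PRECISION
(kinetic half of the quantitative one-block estimate): under the hypotheses of X, for t < T, every
smooth test function χ and components j,k, the time-integrated expected empirical kinetic stress
(N+1)⁻¹Σ χ(x_i) v_{i,j} v_{i,k} and kinetic energy flux (N+1)⁻¹Σ χ(x_i) v_{i,j}|v_i|²/2 along the
deterministic evolution differ from their local-Maxwellian values at the Euler state,
∫χρ_s(u_{s,j}u_{s,k} + θ_s δ_{jk}) and ∫χ(E_s + ρ_sθ_s)u_{s,j}, by at most C (N+1)^(-1/3) (the size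
of the viscous stress / heat flux). The engine cards chapman-enskog-corrector /
kinetic-windows-inside-yau would deliver this; the collisional-transfer half needs a contact-current
definition (Not decomposed yet). [difficulty: open-problem] (why it might fail: Needs an N-uniform
relaxation RATE for the linearised hard-sphere collision dynamics at fixed density plus recollision
control - the Boltzmann-hypothesis step with a rate, unproved for any deterministic interacting
system; the cubic energy flux needs LargeVelocityControl (0781).) [Yau1991, OllaVaradhanYau1993,
Spohn1991, Grad1963, ChapmanCowling1970, VanbeijerenErnst1973]
#3 MeanFieldKnudsenAccuracy (crux) — HYDRODYNAMICS IN THE MEAN TO NAVIER–STOKES PRECISION (card (Q1)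
in its MD-measurable form): under the hypotheses of X, for t < T there is a positive reference
activity a (probability + exponential concentration clauses as in X) and C with Θ_N(t) ≤ C
(N+1)^(-1/3) for all N, where Θ_N(t) = E_{λ^N_t}⟨emp, g_t⟩ − E⟨emp(Φ_{N,t} z), g_t⟩, g_t = log
localGibbsProfile a u_t θ_t = (log a − 3/2·log 2πθ_t − |u_t|²/2θ_t) + v·u_t/θ_t − |v|²/2θ_t: five
expected empirical fields paired with the Euler conjugate variables. One-sided suffices (Θ_N ≥
−O(N^(-2/3)) from H ≥ 0). With EntropySaturationKnudsen this is equivalent to X (foreseen glue).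
[deps: KineticFluxRelaxation] [difficulty: open-problem] (why it might fail: If hydrodynamics holds
in the mean only with o(1) but not O(Kn) error (anomalous relaxation, cf. the N^(-1/6)
Lagrangian-coherence rate) this fails while 0766 survives; for large T compressive smooth solutions
can leave the dilute EOS regime at fixed σ (implosion loophole).) [OllaVaradhanYau1993,
KipnisLandim1999, Spohn1991, arXiv:2412.16714, Yau1991]
#4 KnudsenRateLaw (crux) — THE SECOND-ORDER LAW (card law (1)/(Q2)): there are continuous
coefficient functions η, ζ, κ of (σ; ρ, θ), η, κ > 0, ζ ≥ 0 (the hard-sphere shear/bulk viscosity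
and heat conductivity in Knudsen units — existence claimed, no density expansion, no Enskog values),
universal over profiles, solutions and flows, such that under the hypotheses of X, for t < T:
(N+1)^(1/3)·Θ_N(t) → ∫₀ᵗ∫_𝕋³ [η|S(u)|²/(2θ) + ζ(div u)²/θ + κ|∇θ|²/θ²](s,x) dx ds, S(u) = ∇u + ∇uᵀ −
(2/3)(div u)𝟙, evaluated on the EULER solution: Yau's entropy per particle, magnified by Kn⁻¹,
converges to the Navier–Stokes entropy production the Euler flow would have. Implies
MeanFieldKnudsenAccuracy with the sharp constant and a matching lower bound; it is the statement
event-driven MD tests. [deps: MeanFieldKnudsenAccuracy] [difficulty: open-problem] (why it might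
fail: Requires compressible Navier-Stokes corrections IN THE MEAN for deterministic hard spheres
(open even with noise: only incompressible NS is derived for stochastic lattice gases,
Esposito-Marra-Yau); at fixed σ mode-coupling terms O(Kn^(3/2)) sit close to the O(Kn) signal.)
[Spohn1991, doi:10.1007/bf02517896, doi:10.1002/cpa.3160420810, KipnisLandim1999, Dorfman1999,
EvansMorriss2008, arXiv:1512.02679]
#5 EhrenfestHorizon (crux) — NEGATIVE SIDE — THE log N HORIZON (card (2)/(Q3); candidate entry for
Literature/Barriers/AtomisticToContinuum): there are A, θ₀, σ₀ > 0 such that for 0 < σ < σ₀ and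
every family of flows, for the Kolmogorov local Gibbs data (a ≡ 1, u₀ = A sin(4πx₁)e₀, θ ≡ θ₀; its
Euler solution is steady and smooth for all times, support KolmogorovSteady) there are a continuous
χ and δ, c, C > 0 with, for infinitely many N, P_N(‖momentum field(Φ_{N,t_N} z)(χ) − ∫χu₀‖ > δ) ≥ c
at t_N = C log(N+2): convergence of the empirical fields FAILS along a logarithmic time sequence
although T = ∞. Heuristic: the inviscidly unstable k₀ = 1 mode (Rayleigh; Meshalkin–Sinai;
Belenkaya–Friedlander–Yudovich) starts at thermal amplitude N^(-1/2), is transported by linearised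
Euler (Spohn (7.28)), reaches O(1) with random phase at (2γ)⁻¹ log N; collisional damping ~Kn k² is
irrelevant for fixed k. Outside the conjunct (fixed t), so no contradiction with X; it bounds every
growing-time strengthening and explains the e^{Ct} of relative-entropy Gronwall as sharp. [deps:
KolmogorovSteady] [difficulty: open-problem] (why it might fail: Rests on linearised fluctuating
hydrodynamics up to times ~log N (unproved even at equilibrium); finite Mach number and the
hard-sphere EOS weaken the inviscid Kolmogorov instability; nonlinear saturation might keep the k=1
amplitude below any fixed δ with probability -> 1.) [MeshalkinSinai1961,
doi:10.1137/s0036139997327575, Spohn1991, doi:10.1073/pnas.0401228101,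
doi:10.1103/physreve.105.065113, doi:10.1103/physrevlett.132.104002]
#9 EntropySaturationKnudsen (support) — QUANTITATIVE ENTROPY-SATURATION IDENTITY (glue
MeanFieldKnudsenAccuracy → X; quantified twin of crux 2 of card entropy-saturation-mean-closure):
under the hypotheses of X, for t < T, IF the excess free energy is C² on the density range visited
up to t (∃ η₁, F ∈ C² with hsExcessFreeEnergy = F on [0,η₁] and ρ_sσ³ < η₁ on [0,t]), THEN for EVERY
positive reference activity a whose local Gibbs law is a probability measure with fields
concentrating exponentially around (ρ,ρu,E)(t): |klDiv(lawAt Φ_N P_N t ‖ λ^N_t).toReal/(N+1) −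
Θ_N(t)| ≤ C (N+1)^(-1/3). Proof sketch: H = S(λ^N_t) − S(P_N) + (N+1)Θ_N(t) EXACTLY (Liouville
invariance of differential entropy under the measure-preserving flow; log λ^N_t = (N+1)⟨emp, g_t⟩ −
log Z_N); S(localGibbs)/(N+1) = ∫ρ[3/2·log(2πθ) + 3/2 − log ρ − f_ex(ρσ³)] + O(N^(-2/3) + N⁻¹log N)
(inhomogeneous canonical cluster expansion at small packing); isentropy of classical hs-Euler
solutions under the C² hypothesis (Gibbs relation for p = ρθ(1 + ηf_ex'(η))). [difficulty: L]
[Yau1991, Ruelle1969, LebowitzPenrose1964, SaintRaymond2009, Spohn1991]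
#9 KolmogorovSteady (support) — The Kolmogorov shear data of EhrenfestHorizon is an exact steady
classical hard-sphere Euler solution for every σ and every T: ρ ≡ 1, u(x) = A sin(4π x₁) e₀, θ ≡ θ₀
> 0 (div u = 0, (u·∇)u = 0, p constant; smoothness of x ↦ sin(4π·repr(x)₁) on the torus). Grounds
that the horizon data lie inside the conjunct's hypothesis class with T = ∞. [difficulty:
provable-now] [MeshalkinSinai1961, Spohn1991]

TWO-LAYER PLAN. Foreseen glued splits (none filed now): X ⇐ MeanFieldKnudsenAccuracy →
EntropySaturationKnudsen-instance → X (k = 2; needs the EOS-range side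
condition, discharged at small σ for solutions staying dilute); MeanFieldKnudsenAccuracy ⇐
KineticFluxRelaxation → CollisionalFluxRelaxation →
KnudsenGronwall → MeanFieldKnudsenAccuracy (k = 3: the collisional-transfer twin of crux 2 once a
contact-current definition lands, and Yau's
differential inequality Θ_N(t) ≤ C∫₀ᵗΘ_N + C(N+1)^(-1/3), closed by Gronwall); KnudsenRateLaw ⇐
NSCorrectionInMean (E U_N = U^E + Kn U¹ + o(Kn), U¹ the
linearised Navier–Stokes corrector) → EntropyBalance (S_macro(U^E + KnU¹) − S_macro(U₀) = Kn∫∫σ_s +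
o(Kn)) → KnudsenRateLaw (k = 2).

KILL CRITERIA. MD or theory showing N^(1/3)Θ_N(t) DRIFTS with N at fixed pre-shock t (e.g. grows
like N^(1/6)) refutes MeanFieldKnudsenAccuracy and X together:
close `refuted:MeanFieldKnudsenAccuracy` (the conjunct and 0766 survive; the card's "anomalous
second-order law" becomes a new card). A bounded
but NON-convergent or non-Navier–Stokes limit refutes KnudsenRateLaw only — drop it, keep X.
¬KineticFluxRelaxation with MeanFieldKnudsenAccuracy
intact is impossible at O(Kn) bookkeeping (it would mean O(1) non-equilibrium stresses with
NS-accurate means) — such a refutation signals a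
misstatement; restate. EhrenfestHorizon refuted (uniform-in-log-time convergence for Kolmogorov
data) does not touch the route; EhrenfestHorizon
PROVED is a barrier entry, not a kill. 0766 refuted pre-shock (entropy production ≥ cN for smooth
data) closes this route and RelEntropyErgodic /
ChaoticMixing / VanishingNoise at once. 0766 proved elsewhere moots X as an entrance but not cruxes
4–5.

NOT DECOMPOSED YET. The collisional-transfer half of the flux relaxation (needs a Lean contact
current: flux-weighted trace on the collision boundary, cf.
VirialEosIdentification 0782) and the block (one-block) form Yau's Gronwall actually consumes; the
Gronwall step itself (support-level once crux 2
and its twin exist); the constants η, ζ, κ (Enskog values ± ring corrections — deliberately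
existential in crux 4, see NoDensityExpansion); the
EOS-range side condition (DiluteSelfConsistency of card implosion-loophole) needed to discharge
EntropySaturationKnudsen's hypothesis; the
lower bound liminf N^(1/3)Θ_N > 0 for data with S(u₀) ≠ 0 (contained in crux 4); the d = 2 analogue
(log N corrections, card entropy-loss-and-2d-
litmus); the stable-data horizon t_N ~ N^(1/3) and any uniform-horizon positive statement. All are
layer-2 children or other routes.

CHEAPEST FALSIFIER. Event-driven hard-sphere MD (kit compute; packing fraction 0.05–0.1, N =
10⁴…10⁶, ≥ 10³ local-Gibbs samples): (i) decaying sound wave and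
Taylor–Green-type vortex: plot N^(1/3)Θ_N(t) — Θ_N is the ensemble mean of ONE explicit additive
observable, no entropy estimation — against
∫₀ᵗ∫σ_s[U^E] with Enskog η, ζ, κ; an N-drift at fixed t kills cruxes 3/X, a wrong but N-stable curve
kills only crux 4; (ii) Kolmogorov flow
u₀ = A sin 4πy: departure time of the k_x = 1 momentum mode vs log N (slope (2γ)⁻¹?); no growth of
the departure time with N, or polynomial growth,
kills/changes crux 5. Not run here (hub is compute-free; to be filed as kit jobs by the first
refuter/kit unit). Lookup already done: quantitative
hydrodynamic limits exist only for stochastic lattice gases (arXiv:2212.00079, arXiv:2412.16714) —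
no rate is in print for any Hamiltonian system,
so nothing known kills or proves X cheaply.

NUMBERS. Kn_N = ℓ/L = (√2 π σ²)⁻¹ (N+1)^(-1/3) (Boltzmann mean free path at reduced diameter σ;
Enskog: divide by the contact value χ(φ)); Enskog hard-sphere
transport at packing φ = πρσ³/6: η_E/η₀ = 1/χ + 0.8 b₂ρ + 0.761 (b₂ρ)²χ, κ_E/κ₀ = 1/χ + 1.2 b₂ρ +
0.755 (b₂ρ)²χ, ζ_E/η₀ = 1.002 (b₂ρ)²χ with
b₂ρ = 4φ, η₀ = (5/16σ²)√(θ/π), κ₀ = (75/64σ²)√(θ/π) (ChapmanCowling1970 Ch. 16; Dorfman1999);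
ring/long-time-tail corrections to η at φ ≤ 0.1 are a
few % (EvansMorriss2008 Ch. 1; Alder–Wainwright tails t^(-3/2), integrable in d = 3, so the O(Kn)
order is not renormalised; next order is
Kn^(3/2), not Kn²). Horizon: thermal seed N^(-1/2), inviscid Kolmogorov growth rate γ = O(2πA) for
k₀ = 1 < 2 (BFY 1999), t_N = (2γ)⁻¹ log N; stable
data: t_N ≳ N^(1/3)/k². Items at open: 8 (1 target, 4 cruxes, 2 support, 1 assembly).

DEFINITION REQUESTS. None needed to STATE the items (all eight elaborate over
Literature.MathematicalPhysics.KineticTheory.* , Literature.Analysis.FluidPDE.* and the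
torus calculus). Wanted later (filed when crux 2 moves): `hsContactCurrent` — the collisional
momentum/energy transfer of an N-sphere law as a
flux-weighted trace on the collision boundary (topic Literature/MathematicalPhysics/KineticTheory;
shared with VirialEosIdentification 0782 and
card chapman-enskog-corrector). Barrier-candidate request: EhrenfestHorizon as
`Literature/Barriers/AtomisticToContinuum/EhrenfestHorizon`
(technique_class: uniform-in-time / growing-horizon strengthenings; formal kernel: unstable spectrum
of inviscid Kolmogorov flow, BFY 1999;
status: conjecture for hard spheres) — filed as a cite work item after open.

Novelty: Searches (2026-08-15): `lit search --source zbmath` × 11 queries ("hydrodynamic limit" "rate of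
convergence" relative entropy → 1 hit
arXiv:2412.16714; Menegaki Mouhot quantitative hydrodynamic limit → arXiv:2212.00079,
arXiv:2412.16714; Esposito Marra Yau Navier-Stokes lattice →
doi:10.1007/bf02517896, doi:10.1214/07-aihp125; "Navier-Stokes correction" hydrodynamic limit
particle → 0; Belenkaya Friedlander Yudovich →
doi:10.1137/s0036139997327575; De Masi Esposito Lebowitz → doi:10.1002/cpa.3160420810; Alder
Wainwright → arXiv:1512.02679; Kadau Germann →
doi:10.1098/rsta.2009.0218); `lit search --source crossref` × 3 (Kadau PNAS
doi:10.1073/pnas.0401228101; Bandak et al. doi:10.1103/physreve.105.065113,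
doi:10.1103/physrevlett.132.104002); `lit frontier AtomisticToContinuum --since 2020` (30 rows:
Deng–Hani–Ma descendants, Canestrari–Liverani–Olla
arXiv:2310.13338, a 2026 JSP "Fluctuations and moderate deviations for a binary collision model" —
nothing quantitative for Hamiltonian/hard-sphere
hydrodynamics); `lit bridges AtomisticToContinuum --cross any` (30 rows, none relevant); `lit galaxy
search "relative entropy method hydrodynamic
limit rate of convergence" --star all` (0 substring hits; three further galaxy queries queued-out,
rc "saturated"); local `lit search` and
OpenAlex/S2/arXiv remotes DOWN or rate-limited this session (connection reset / HTTP 429) — refuter: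
rerun `lit search --hybrid "Navier-Stokes
correction relative entropy hydrodynamic limit"` and `"Ehrenfes  [refs: 10.1007/bf02517896, 10.1214/07-aihp125, 10.1137/s0036139997327575, 10.1002/cpa.3160420810, 10.1098/rsta.2009.0218, 10.1073/pnas.0401228101, 10.1103/physreve.105.065113, 10.1103/physrevlett.132.104002, 2412.16714, 2212.00079, 1512.02679, 2310.13338, doi:10.1007/bf02517896, doi:10.1214/07-aihp125, doi:10.1137/s0036139997327575, doi:10.1002/cpa.3160420810, doi:10.1098/rsta.2009.0218, doi:10.1073/pnas]

Barriers (technique_class: relative-entropy, knudsen-rate, quantitative-target): - technique_class: relative-entropy, knudsen-rate, quantitative-target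
- Literature.Barriers.AtomisticToContinuum.BoltzmannHypothesisBarrier: it does not evade it; the bet
is that the closure input is needed only in the MEAN and with a RATE (crux KineticFluxRelaxation:
fast moments relax within O(1) collision times), which is where the engine cards
(chapman-enskog-corrector, kinetic-windows-inside-yau) attack; this route changes the FORM of the
target (rate, one linear statistic), not the ergodic input, and says so.
- Literature.Barriers.AtomisticToContinuum.HighMomentumCutoffBarrier: inherited — the kinetic energy
flux in crux 2 is cubic in v and the true kinetic energy cannot be modified; delegated to
LargeVelocityControl (0781) / card apriori-tails-and-rattlers; cruxes 3–4 and X involve only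
quadratic velocity statistics (g_t is quadratic in v), so the target itself needs no cubic
exponential moments.
- Literature.Barriers.AtomisticToContinuum.HighMomentumCutoffBarrierNarrow: it does not evade it for
crux KineticFluxRelaxation — the convective kinetic energy flux Σχ(x_i)v_i|v_i|²/2 is exactly the
cubic current whose entropy-inequality control fails against Gaussian references; the bet is the new
a priori input named there (LargeVelocityControl 0781 / propagation of velocity moments by the
collision dynamics, card apriori-tails-and-rattlers); the target X, cruxes 3–4 and the support
identity involve only QUADRATIC velocity statistics (g_t = λ⁰ + λ·v − |v|²/2θ_t), so the ent

History (route lifecycle, newest last):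
- 2026-08-15T13:43:41Z · CLOSED retired — not-a-thesis: assembly does not conclude the sub-problem Statement (operator:999:1257524)

sub-problem: HydrodynamicLimit · status: closed(retired) · opened planner-plancard-AtomisticToContinuum-Hydrody-bfad0257-0 2026-08-15T11:40:22Z · rev 0 · ledger route-AtomisticToContinuum-KnudsenRate
GENERATED by the gate from the ledger (D-0016/17). Provers cite these decls: `theorem foo : Summit.AtomisticToContinuum.HydrodynamicLimit.Theses.KnudsenRate.<Decl> := …` in Summits/AtomisticToContinuum/HydrodynamicLimit/Theorems/<Name>.lean.
-/

namespace Summit.AtomisticToContinuum.HydrodynamicLimit.Theses.KnudsenRate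

open scoped BigOperators Topology Manifold Classical MeasureTheory ProbabilityTheory Matrix InnerProductSpace ComplexConjugate ContinuousMap
open Filter Set Function TopologicalSpace MeasureTheory

attribute [summit_statement] _root_.HydrodynamicLimit

/-- item stmt-AtomisticToContinuum-5218 · target · rank 0 · closed · moot by None · by planner
why it might fail: Strictly stronger than the conjunct: if local equilibrium is reached only at an anomalous algebraic rate slower than Kn = N^(-1/3) (e.g. N^(-1/6)), 0766 holds and X fails; inherits the Boltzmann-hypothesis and large-velocity obstructions of 0766.
sources: Yau1991, OllaVaradhanYau1993, KipnisLandim1999, Spohn1991, arXiv:2212.00079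
[target] X as in § Thesis: the 0766-shaped statement with the conclusion ∃ a (probability,
exponential concentration of the reference fields around (ρ,ρu,E)(t)) ∧ ∃ C ∀ N, klDiv(lawAt Φ_N
(localGibbs a₀u₀θ₀) t ‖ localGibbs a u_t θ_t) ≤ C (N+1)^(2/3). Card items (Q1)/(Q5). -/
@[route_item "route-AtomisticToContinuum-KnudsenRate"]
def EntropyKnudsenRate : Prop :=
  ∀ (a₀ θ₀ : Literature.MathematicalPhysics.KineticTheory.T3 → ℝ) (u₀ : Literature.MathematicalPhysics.KineticTheory.T3 → Literature.MathematicalPhysics.KineticTheory.V3), Continuous a₀ → Continuous θ₀ → Continuous u₀ → (∀ x, 0 < a₀ x) → (∀ x, 0 < θ₀ x) → ∃ σ₀ : ℝ, 0 < σ₀ ∧ ∀ σ : ℝ, 0 < σ → σ < σ₀ → ∀ (T : ℝ) (ρ θ : ℝ → Literature.MathematicalPhysics.KineticTheory.T3 → ℝ) (u : ℝ → Literature.MathematicalPhysics.KineticTheory.T3 → Literature.MathematicalPhysics.KineticTheory.V3), Literature.MathematicalPhysics.KineticTheory.IsHardSphereEulerSolution σ T ρ u θ → ∀ Φ : (N :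 ℕ) → Literature.Analysis.FluidPDE.HardSphereFlow (Literature.Analysis.FluidPDE.Torus.geometry (Fin 3)) (Literature.MathematicalPhysics.KineticTheory.hsDiameter σ N) (N + 1), (∀ N, MeasureTheory.IsProbabilityMeasure (Literature.MathematicalPhysics.KineticTheory.localGibbsLaw σ a₀ u₀ θ₀ N (Φ N))) ∧ (Literature.MathematicalPhysics.KineticTheory.TendstoHydroFieldsAt (fun N => Literature.MathematicalPhysics.KineticTheory.localGibbsLaw σ a₀ u₀ θ₀ N (Φ N)) Φ ρ u θ 0 → ∀ t ∈ Set.Ico 0 T, ∃ a : Literature.MathematicalPhysics.KineticTheory.T3 → ℝ, (∀ N, MeasureTheory.IsProbabilityMeasure (Literature.MathematicalPhysics.KineticTheory.localGibbsLaw σ a (u t) (θ t) N (Φ N))) ∧ (∀ χ : Literature.MathematicalPhysics.KineticTheory.T3 → ℝ, Continuous χ → ∀ δ : ℝ, 0 < δ → ∃ C : ℝ, 0 < C ∧ ∀ N : ℕ, Literature.MathematicalPhysics.KineticTheory.localGibbsLaw σ a (u t) (θ t) N (Φ N) {z | δ < |Literature.MathematicalPhysics.KineticTheory.empiricalDensityField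 z χ - ∫ x, χ x * ρ t x|} ≤ ENNReal.ofReal (C * Real.exp (-(C⁻¹ * (N + 1)))) ∧ Literature.MathematicalPhysics.KineticTheory.localGibbsLaw σ a (u t) (θ t) N (Φ N) {z | δ < ‖Literature.MathematicalPhysics.KineticTheory.empiricalMomentumField z χ - ∫ x, (χ x * ρ t x) • u t x‖} ≤ ENNReal.ofReal (C * Real.exp (-(C⁻¹ * (N + 1)))) ∧ Literature.MathematicalPhysics.KineticTheory.localGibbsLaw σ a (u t) (θ t) N (Φ N) {z | δ < |Literature.MathematicalPhysics.KineticTheory.empiricalEnergyField z χ - ∫ x, χ x * Literature.MathematicalPhysics.KineticTheory.totalEnergyDensity (ρ t x) (u t x) (θ t x)|} ≤ ENNReal.ofReal (C * Real.exp (-(C⁻¹ * (N + 1))))) ∧ ∃ C : ℝ, ∀ N : ℕ, InformationTheory.klDiv ((Φ N).lawAt (Literature.MathematicalPhysics.KineticTheory.localGibbsLaw σ a₀ u₀ θ₀ N (Φ N)) t) (Literature.MathematicalPhysics.KineticTheory.localGibbsLaw σ a (u t) (θ t) N (Φ N)) ≤ ENNReal.ofReal (C * ((N : ℝ) + 1)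 ^ (2 / 3 : ℝ)))

/-- item stmt-AtomisticToContinuum-5219 · crux · rank 2 · closed · moot by None · by planner
why it might fail: Needs an N-uniform relaxation RATE for the linearised hard-sphere collision dynamics at fixed density plus recollision control - the Boltzmann-hypothesis step with a rate, unproved for any deterministic interacting system; the cubic energy flux needs LargeVelocityControl (0781).
sources: Yau1991, OllaVaradhanYau1993, Spohn1991, Grad1963, ChapmanCowling1970, VanbeijerenErnst1973
[crux] LOCAL EQUILIBRIUM OF THE FAST MOMENTS AT KNUDSEN PRECISION (kinetic half of the quantitative
one-block estimate): under the hypotheses of X, for t < T, every smooth test function χ and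
components j,k, the time-integrated expected empirical kinetic stress (N+1)⁻¹Σ χ(x_i) v_{i,j}
v_{i,k} and kinetic energy flux (N+1)⁻¹Σ χ(x_i) v_{i,j}|v_i|²/2 along the deterministic evolution
differ from their local-Maxwellian values at the Euler state, ∫χρ_s(u_{s,j}u_{s,k} + θ_s δ_{jk}) and
∫χ(E_s + ρ_sθ_s)u_{s,j}, by at most C (N+1)^(-1/3) (the size of the viscous stress / heat flux). The
engine cards chapman-enskog-corrector / kinetic-windows-inside-yau would deliver this; the
collisional-transfer half needs a contact-current definition (Not decomposed yet). [difficulty: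
open-problem] -/
@[route_item "route-AtomisticToContinuum-KnudsenRate"]
def KineticFluxRelaxation : Prop :=
  ∀ (a₀ θ₀ : Literature.MathematicalPhysics.KineticTheory.T3 → ℝ) (u₀ : Literature.MathematicalPhysics.KineticTheory.T3 → Literature.MathematicalPhysics.KineticTheory.V3), Continuous a₀ → Continuous θ₀ → Continuous u₀ → (∀ x, 0 < a₀ x) → (∀ x, 0 < θ₀ x) → ∃ σ₀ : ℝ, 0 < σ₀ ∧ ∀ σ : ℝ, 0 < σ → σ < σ₀ → ∀ (T : ℝ) (ρ θ : ℝ → Literature.MathematicalPhysics.KineticTheory.T3 → ℝ) (u : ℝ → Literature.MathematicalPhysics.KineticTheory.T3 → Literature.MathematicalPhysics.KineticTheory.V3), Literature.MathematicalPhysics.KineticTheory.IsHardSphereEulerSolution σ T ρ u θ → ∀ Φ : (N : ℕ) → Literature.Analysis.FluidPDE.HardSphereFlow (Literature.Analysis.FluidPDE.Torus.geometry (Fin 3)) (Literature.MathematicalPhysics.KineticTheory.hsDiameter σ N) (N + 1), (∀ N, MeasureTheory.IsProbabilityMeasure (Literature.MathematicalPhysics.KineticTheory.localGibbsLaw σ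 a₀ u₀ θ₀ N (Φ N))) ∧ (Literature.MathematicalPhysics.KineticTheory.TendstoHydroFieldsAt (fun N => Literature.MathematicalPhysics.KineticTheory.localGibbsLaw σ a₀ u₀ θ₀ N (Φ N)) Φ ρ u θ 0 → ∀ t ∈ Set.Ico 0 T, ∀ χ : Literature.MathematicalPhysics.KineticTheory.T3 → ℝ, Literature.Analysis.FunctionSpaces.Torus.IsSmooth χ → ∀ j k : Fin 3, ∃ C : ℝ, ∀ N : ℕ, |∫ s in (0 : ℝ)..t, ((∫ z, (∫ y, χ y.1 * (y.2 j * y.2 k) ∂(Literature.Analysis.FluidPDE.empiricalMeasure ((Φ N).flow s z))) ∂(Literature.MathematicalPhysics.KineticTheory.localGibbsLaw σ a₀ u₀ θ₀ N (Φ N))) - ∫ x, χ x * (ρ s x * (u s x j * u s x k + if j = k then θ s x else 0)))| ≤ C * ((N : ℝ) + 1) ^ (-(1 / 3 : ℝ)) ∧ |∫ s in (0 : ℝ)..t, ((∫ z, (∫ y, χ y.1 * (‖y.2‖ ^ 2 / 2 * y.2 j) ∂(Literature.Analysis.FluidPDE.empiricalMeasure ((Φ N).flow s z))) ∂(Literature.MathematicalPhysics.KineticTheory.localGibbsLaw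 σ a₀ u₀ θ₀ N (Φ N))) - ∫ x, χ x * ((Literature.MathematicalPhysics.KineticTheory.totalEnergyDensity (ρ s x) (u s x) (θ s x) + ρ s x * θ s x) * u s x j))| ≤ C * ((N : ℝ) + 1) ^ (-(1 / 3 : ℝ)))

/-- item stmt-AtomisticToContinuum-5220 · crux · rank 3 · closed · moot by None · by planner
why it might fail: If hydrodynamics holds in the mean only with o(1) but not O(Kn) error (anomalous relaxation, cf. the N^(-1/6) Lagrangian-coherence rate) this fails while 0766 survives; for large T compressive smooth solutions can leave the dilute EOS regime at fixed σ (implosion loophole).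
sources: OllaVaradhanYau1993, KipnisLandim1999, Spohn1991, arXiv:2412.16714, Yau1991
[crux] HYDRODYNAMICS IN THE MEAN TO NAVIER–STOKES PRECISION (card (Q1) in its MD-measurable form):
under the hypotheses of X, for t < T there is a positive reference activity a (probability +
exponential concentration clauses as in X) and C with Θ_N(t) ≤ C (N+1)^(-1/3) for all N, where
Θ_N(t) = E_{λ^N_t}⟨emp, g_t⟩ − E⟨emp(Φ_{N,t} z), g_t⟩, g_t = log localGibbsProfile a u_t θ_t = (log
a − 3/2·log 2πθ_t − |u_t|²/2θ_t) + v·u_t/θ_t − |v|²/2θ_t: five expected empirical fields paired with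
the Euler conjugate variables. One-sided suffices (Θ_N ≥ −O(N^(-2/3)) from H ≥ 0). With
EntropySaturationKnudsen this is equivalent to X (foreseen glue). [deps: KineticFluxRelaxation]
[difficulty: open-problem] -/
@[route_item "route-AtomisticToContinuum-KnudsenRate"]
def MeanFieldKnudsenAccuracy : Prop :=
  ∀ (a₀ θ₀ : Literature.MathematicalPhysics.KineticTheory.T3 → ℝ) (u₀ : Literature.MathematicalPhysics.KineticTheory.T3 → Literature.MathematicalPhysics.KineticTheory.V3), Continuous a₀ → Continuous θ₀ → Continuous u₀ → (∀ x, 0 < a₀ x) → (∀ x, 0 < θ₀ x) → ∃ σ₀ : ℝ, 0 < σ₀ ∧ ∀ σ : ℝ, 0 < σ → σ < σ₀ → ∀ (T : ℝ) (ρ θ : ℝ → Literature.MathematicalPhysics.KineticTheory.T3 → ℝ) (u : ℝ → Literature.MathematicalPhysics.KineticTheory.T3 → Literature.MathematicalPhysics.KineticTheory.V3), Literature.MathematicalPhysics.KineticTheory.IsHardSphereEulerSolution σ T ρ u θ → ∀ Φ : (N : ℕ) → Literature.Analysis.FluidPDE.HardSphereFlow (Literature.Analysis.FluidPDE.Torus.geometry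 (Fin 3)) (Literature.MathematicalPhysics.KineticTheory.hsDiameter σ N) (N + 1), (∀ N, MeasureTheory.IsProbabilityMeasure (Literature.MathematicalPhysics.KineticTheory.localGibbsLaw σ a₀ u₀ θ₀ N (Φ N))) ∧ (Literature.MathematicalPhysics.KineticTheory.TendstoHydroFieldsAt (fun N => Literature.MathematicalPhysics.KineticTheory.localGibbsLaw σ a₀ u₀ θ₀ N (Φ N)) Φ ρ u θ 0 → ∀ t ∈ Set.Ico 0 T, ∃ a : Literature.MathematicalPhysics.KineticTheory.T3 → ℝ, (∀ x, 0 < a x) ∧ (∀ N, MeasureTheory.IsProbabilityMeasure (Literature.MathematicalPhysics.KineticTheory.localGibbsLaw σ a (u t) (θ t) N (Φ N))) ∧ (∀ χ : Literature.MathematicalPhysics.KineticTheory.T3 → ℝ, Continuous χ → ∀ δ : ℝ, 0 < δ → ∃ C : ℝ, 0 < C ∧ ∀ N : ℕ, Literature.MathematicalPhysics.KineticTheory.localGibbsLaw σ a (u t) (θ t) N (Φ N) {z | δ < |Literature.MathematicalPhysics.KineticTheory.empiricalDensityField z χ - ∫ x, χ x * ρ t x|} ≤ ENNReal.ofReal (C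 * Real.exp (-(C⁻¹ * (N + 1)))) ∧ Literature.MathematicalPhysics.KineticTheory.localGibbsLaw σ a (u t) (θ t) N (Φ N) {z | δ < ‖Literature.MathematicalPhysics.KineticTheory.empiricalMomentumField z χ - ∫ x, (χ x * ρ t x) • u t x‖} ≤ ENNReal.ofReal (C * Real.exp (-(C⁻¹ * (N + 1)))) ∧ Literature.MathematicalPhysics.KineticTheory.localGibbsLaw σ a (u t) (θ t) N (Φ N) {z | δ < |Literature.MathematicalPhysics.KineticTheory.empiricalEnergyField z χ - ∫ x, χ x * Literature.MathematicalPhysics.KineticTheory.totalEnergyDensity (ρ t x) (u t x) (θ t x)|} ≤ ENNReal.ofReal (C * Real.exp (-(C⁻¹ * (N + 1))))) ∧ ∃ C : ℝ, ∀ N : ℕ, ((∫ z, (∫ y, Real.log (Literature.MathematicalPhysics.KineticTheory.localGibbsProfile a (u t) (θ t) y) ∂(Literature.Analysis.FluidPDE.empiricalMeasure z)) ∂(Literature.MathematicalPhysics.KineticTheory.localGibbsLaw σ a (u t) (θ t) N (Φ N))) - (∫ z, (∫ y, Real.log (Literature.MathematicalPhysics.KineticTheory.localGibbsProfile a (u t)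 (θ t) y) ∂(Literature.Analysis.FluidPDE.empiricalMeasure ((Φ N).flow t z))) ∂(Literature.MathematicalPhysics.KineticTheory.localGibbsLaw σ a₀ u₀ θ₀ N (Φ N)))) ≤ C * ((N : ℝ) + 1) ^ (-(1 / 3 : ℝ)))

/-- item stmt-AtomisticToContinuum-5221 · crux · rank 4 · closed · moot by None · by planner
why it might fail: Requires compressible Navier-Stokes corrections IN THE MEAN for deterministic hard spheres (open even with noise: only incompressible NS is derived for stochastic lattice gases, Esposito-Marra-Yau); at fixed σ mode-coupling terms O(Kn^(3/2)) sit close to the O(Kn) signal.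
sources: Spohn1991, doi:10.1007/bf02517896, doi:10.1002/cpa.3160420810, KipnisLandim1999, Dorfman1999, EvansMorriss2008
[crux] THE SECOND-ORDER LAW (card law (1)/(Q2)): there are continuous coefficient functions η, ζ, κ
of (σ; ρ, θ), η, κ > 0, ζ ≥ 0 (the hard-sphere shear/bulk viscosity and heat conductivity in Knudsen
units — existence claimed, no density expansion, no Enskog values), universal over profiles,
solutions and flows, such that under the hypotheses of X, for t < T: (N+1)^(1/3)·Θ_N(t) → ∫₀ᵗ∫_𝕋³
[η|S(u)|²/(2θ) + ζ(div u)²/θ + κ|∇θ|²/θ²](s,x) dx ds, S(u) = ∇u + ∇uᵀ − (2/3)(div u)𝟙, evaluated on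
the EULER solution: Yau's entropy per particle, magnified by Kn⁻¹, converges to the Navier–Stokes
entropy production the Euler flow would have. Implies MeanFieldKnudsenAccuracy with the sharp
constant and a matching lower bound; it is the statement event-driven MD tests. [deps:
MeanFieldKnudsenAccuracy] [difficulty: open-problem] -/
@[route_item "route-AtomisticToContinuum-KnudsenRate"]
def KnudsenRateLaw : Prop :=
  ∃ η ζ κ : ℝ → ℝ → ℝ → ℝ, (∀ σ : ℝ, 0 < σ → Continuous (fun p : ℝ × ℝ => (η σ p.1 p.2, ζ σ p.1 p.2, κ σ p.1 p.2))) ∧ (∀ σ r ϑ : ℝ, 0 < σ → 0 < r → 0 < ϑ → 0 < η σ r ϑ ∧ 0 ≤ ζ σ r ϑ ∧ 0 < κ σ r ϑ) ∧ ∀ (a₀ θ₀ : Literature.MathematicalPhysics.KineticTheory.T3 → ℝ) (u₀ : Literature.MathematicalPhysics.KineticTheory.T3 → Literature.MathematicalPhysics.KineticTheory.V3), Continuous a₀ → Continuous θ₀ → Continuous u₀ → (∀ x, 0 < a₀ x) → (∀ x, 0 < θ₀ x) → ∃ σ₀ : ℝ, 0 < σ₀ ∧ ∀ σ : ℝ,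 0 < σ → σ < σ₀ → ∀ (T : ℝ) (ρ θ : ℝ → Literature.MathematicalPhysics.KineticTheory.T3 → ℝ) (u : ℝ → Literature.MathematicalPhysics.KineticTheory.T3 → Literature.MathematicalPhysics.KineticTheory.V3), Literature.MathematicalPhysics.KineticTheory.IsHardSphereEulerSolution σ T ρ u θ → ∀ Φ : (N : ℕ) → Literature.Analysis.FluidPDE.HardSphereFlow (Literature.Analysis.FluidPDE.Torus.geometry (Fin 3)) (Literature.MathematicalPhysics.KineticTheory.hsDiameter σ N) (N + 1), (∀ N, MeasureTheory.IsProbabilityMeasure (Literature.MathematicalPhysics.KineticTheory.localGibbsLaw σ a₀ u₀ θ₀ N (Φ N))) ∧ (Literature.MathematicalPhysics.KineticTheory.TendstoHydroFieldsAt (fun N => Literature.MathematicalPhysics.KineticTheory.localGibbsLaw σ a₀ u₀ θ₀ N (Φ N)) Φ ρ u θ 0 → ∀ t ∈ Set.Ico 0 T, ∃ a : Literature.MathematicalPhysics.KineticTheory.T3 → ℝ, (∀ x, 0 < a x) ∧ (∀ N, MeasureTheory.IsProbabilityMeasure (Literature.MathematicalPhysics.KineticTheory.localGibbsLaw σ a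 (u t) (θ t) N (Φ N))) ∧ (∀ χ : Literature.MathematicalPhysics.KineticTheory.T3 → ℝ, Continuous χ → ∀ δ : ℝ, 0 < δ → ∃ C : ℝ, 0 < C ∧ ∀ N : ℕ, Literature.MathematicalPhysics.KineticTheory.localGibbsLaw σ a (u t) (θ t) N (Φ N) {z | δ < |Literature.MathematicalPhysics.KineticTheory.empiricalDensityField z χ - ∫ x, χ x * ρ t x|} ≤ ENNReal.ofReal (C * Real.exp (-(C⁻¹ * (N + 1)))) ∧ Literature.MathematicalPhysics.KineticTheory.localGibbsLaw σ a (u t) (θ t) N (Φ N) {z | δ < ‖Literature.MathematicalPhysics.KineticTheory.empiricalMomentumField z χ - ∫ x, (χ x * ρ t x) • u t x‖} ≤ ENNReal.ofReal (C * Real.exp (-(C⁻¹ * (N + 1)))) ∧ Literature.MathematicalPhysics.KineticTheory.localGibbsLaw σ a (u t) (θ t) N (Φ N) {z | δ < |Literature.MathematicalPhysics.KineticTheory.empiricalEnergyField z χ - ∫ x, χ x * Literature.MathematicalPhysics.KineticTheory.totalEnergyDensity (ρ t x) (u t x) (θ t x)|} ≤ ENNReal.ofReal (C * Real.exp (-(C⁻¹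 * (N + 1))))) ∧ Filter.Tendsto (fun N : ℕ => ((N : ℝ) + 1) ^ (1 / 3 : ℝ) * ((∫ z, (∫ y, Real.log (Literature.MathematicalPhysics.KineticTheory.localGibbsProfile a (u t) (θ t) y) ∂(Literature.Analysis.FluidPDE.empiricalMeasure z)) ∂(Literature.MathematicalPhysics.KineticTheory.localGibbsLaw σ a (u t) (θ t) N (Φ N))) - (∫ z, (∫ y, Real.log (Literature.MathematicalPhysics.KineticTheory.localGibbsProfile a (u t) (θ t) y) ∂(Literature.Analysis.FluidPDE.empiricalMeasure ((Φ N).flow t z))) ∂(Literature.MathematicalPhysics.KineticTheory.localGibbsLaw σ a₀ u₀ θ₀ N (Φ N))))) Filter.atTop (nhds (∫ s in (0 : ℝ)..t, ∫ x, (η σ (ρ s x) (θ s x) / (2 * θ s x) * (∑ i : Fin 3, ∑ j : Fin 3, (Literature.Analysis.FunctionSpaces.Torus.partialDeriv i (fun y => u s y j) x + Literature.Analysis.FunctionSpaces.Torus.partialDeriv j (fun y => u s y i) x - (if i = j then (2 / 3 : ℝ) * Literature.Analysis.FunctionSpaces.Torus.divergence (u s) x else 0)) ^ 2) + ζ σ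 (ρ s x) (θ s x) / θ s x * (Literature.Analysis.FunctionSpaces.Torus.divergence (u s) x) ^ 2 + κ σ (ρ s x) (θ s x) / (θ s x) ^ 2 * ‖Literature.Analysis.FunctionSpaces.Torus.gradient (θ s) x‖ ^ 2))))

/-- item stmt-AtomisticToContinuum-5222 · crux · rank 5 · closed · moot by None · by planner
why it might fail: Rests on linearised fluctuating hydrodynamics up to times ~log N (unproved even at equilibrium); finite Mach number and the hard-sphere EOS weaken the inviscid Kolmogorov instability; nonlinear saturation might keep the k=1 amplitude below any fixed δ with probability -> 1.
sources: MeshalkinSinai1961, doi:10.1137/s0036139997327575, Spohn1991, doi:10.1073/pnas.0401228101, doi:10.1103/physreve.105.065113, doi:10.1103/physrevlett.132.104002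
[crux] NEGATIVE SIDE — THE log N HORIZON (card (2)/(Q3); candidate entry for
Literature/Barriers/AtomisticToContinuum): there are A, θ₀, σ₀ > 0 such that for 0 < σ < σ₀ and
every family of flows, for the Kolmogorov local Gibbs data (a ≡ 1, u₀ = A sin(4πx₁)e₀, θ ≡ θ₀; its
Euler solution is steady and smooth for all times, support KolmogorovSteady) there are a continuous
χ and δ, c, C > 0 with, for infinitely many N, P_N(‖momentum field(Φ_{N,t_N} z)(χ) − ∫χu₀‖ > δ) ≥ c
at t_N = C log(N+2): convergence of the empirical fields FAILS along a logarithmic time sequence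
although T = ∞. Heuristic: the inviscidly unstable k₀ = 1 mode (Rayleigh; Meshalkin–Sinai;
Belenkaya–Friedlander–Yudovich) starts at thermal amplitude N^(-1/2), is transported by linearised
Euler (Spohn (7.28)), reaches O(1) with random phase at (2γ)⁻¹ log N; collisional damping ~Kn k² is
irrelevant for fixed k. Outside the conjunct (fixed t), so no contradiction with X; it bounds every
growing-time strengthening and explains the e^{Ct} of relative-entropy Gronwall as sharp. [deps:
KolmogorovSteady] [difficulty: open-problem] -/
@[route_item "route-AtomisticToContinuum-KnudsenRate"]
def EhrenfestHorizon : Prop :=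
  ∃ A θ₀ σ₀ : ℝ, 0 < A ∧ 0 < θ₀ ∧ 0 < σ₀ ∧ ∀ σ : ℝ, 0 < σ → σ < σ₀ → ∀ Φ : (N : ℕ) → Literature.Analysis.FluidPDE.HardSphereFlow (Literature.Analysis.FluidPDE.Torus.geometry (Fin 3)) (Literature.MathematicalPhysics.KineticTheory.hsDiameter σ N) (N + 1), ∃ χ : Literature.MathematicalPhysics.KineticTheory.T3 → ℝ, Continuous χ ∧ ∃ δ c C : ℝ, 0 < δ ∧ 0 < c ∧ 0 < C ∧ ∃ᶠ N : ℕ in Filter.atTop, ENNReal.ofReal c ≤ (Literature.MathematicalPhysics.KineticTheory.localGibbsLaw σ (fun _ => 1) (fun x : Literature.MathematicalPhysics.KineticTheory.T3 => (A * Real.sin (4 * Real.pi * (Literature.Analysis.FunctionSpaces.Torus.repr x) 1)) • EuclideanSpace.single (0 : Fin 3) (1 : ℝ)) (fun _ => θ₀) N (Φ N)) {z | δ < ‖Literature.MathematicalPhysics.KineticTheory.empiricalMomentumField ((Φ N).flow (C * Real.log ((N : ℝ) + 2)) z) χ - ∫ x, χ x • (fun x : Literature.MathematicalPhysics.KineticTheory.T3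 => (A * Real.sin (4 * Real.pi * (Literature.Analysis.FunctionSpaces.Torus.repr x) 1)) • EuclideanSpace.single (0 : Fin 3) (1 : ℝ)) x‖}

/-- item stmt-AtomisticToContinuum-5223 · support · rank 9 · closed · moot by None · by planner
sources: Yau1991, Ruelle1969, LebowitzPenrose1964, SaintRaymond2009, Spohn1991
[support] QUANTITATIVE ENTROPY-SATURATION IDENTITY (glue MeanFieldKnudsenAccuracy → X; quantified
twin of crux 2 of card entropy-saturation-mean-closure): under the hypotheses of X, for t < T, IF
the excess free energy is C² on the density range visited up to t (∃ η₁, F ∈ C² with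
hsExcessFreeEnergy = F on [0,η₁] and ρ_sσ³ < η₁ on [0,t]), THEN for EVERY positive reference
activity a whose local Gibbs law is a probability measure with fields concentrating exponentially
around (ρ,ρu,E)(t): |klDiv(lawAt Φ_N P_N t ‖ λ^N_t).toReal/(N+1) − Θ_N(t)| ≤ C (N+1)^(-1/3). Proof
sketch: H = S(λ^N_t) − S(P_N) + (N+1)Θ_N(t) EXACTLY (Liouville invariance of differential entropy
under the measure-preserving flow; log λ^N_t = (N+1)⟨emp, g_t⟩ − log Z_N); S(localGibbs)/(N+1) =
∫ρ[3/2·log(2πθ) + 3/2 − log ρ − f_ex(ρσ³)] + O(N^(-2/3) + N⁻¹log N) (inhomogeneous canonical cluster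
expansion at small packing); isentropy of classical hs-Euler solutions under the C² hypothesis
(Gibbs relation for p = ρθ(1 + ηf_ex'(η))). [difficulty: L] -/
@[route_item "route-AtomisticToContinuum-KnudsenRate"]
def EntropySaturationKnudsen : Prop :=
  ∀ (a₀ θ₀ : Literature.MathematicalPhysics.KineticTheory.T3 → ℝ) (u₀ : Literature.MathematicalPhysics.KineticTheory.T3 → Literature.MathematicalPhysics.KineticTheory.V3), Continuous a₀ → Continuous θ₀ → Continuous u₀ → (∀ x, 0 < a₀ x) → (∀ x, 0 < θ₀ x) → ∃ σ₀ : ℝ, 0 < σ₀ ∧ ∀ σ : ℝ, 0 < σ → σ < σ₀ → ∀ (T : ℝ) (ρ θ : ℝ → Literature.MathematicalPhysics.KineticTheory.T3 → ℝ) (u : ℝ → Literature.MathematicalPhysics.KineticTheory.T3 → Literature.MathematicalPhysics.KineticTheory.V3), Literature.MathematicalPhysics.KineticTheory.IsHardSphereEulerSolution σ T ρ u θ → ∀ Φ : (N : ℕ) → Literature.Analysis.FluidPDE.HardSphereFlow (Literature.Analysis.FluidPDE.Torus.geometry (Fin 3)) (Literature.MathematicalPhysics.KineticTheory.hsDiameter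 σ N) (N + 1), (∀ N, MeasureTheory.IsProbabilityMeasure (Literature.MathematicalPhysics.KineticTheory.localGibbsLaw σ a₀ u₀ θ₀ N (Φ N))) ∧ (Literature.MathematicalPhysics.KineticTheory.TendstoHydroFieldsAt (fun N => Literature.MathematicalPhysics.KineticTheory.localGibbsLaw σ a₀ u₀ θ₀ N (Φ N)) Φ ρ u θ 0 → ∀ t ∈ Set.Ico 0 T, (∃ η₁ : ℝ, ∃ Fex : ℝ → ℝ, ContDiff ℝ 2 Fex ∧ Set.EqOn Literature.MathematicalPhysics.KineticTheory.hsExcessFreeEnergy Fex (Set.Icc 0 η₁) ∧ ∀ s ∈ Set.Icc 0 t, ∀ x, ρ s x * σ ^ 3 < η₁) → ∀ a : Literature.MathematicalPhysics.KineticTheory.T3 → ℝ, (∀ x, 0 < a x) → (∀ N, MeasureTheory.IsProbabilityMeasure (Literature.MathematicalPhysics.KineticTheory.localGibbsLaw σ a (u t) (θ t) N (Φ N))) → (∀ χ : Literature.MathematicalPhysics.KineticTheory.T3 → ℝ, Continuous χ → ∀ δ : ℝ, 0 < δ → ∃ C : ℝ, 0 < C ∧ ∀ N : ℕ, Literature.MathematicalPhysics.KineticTheory.localGibbsLaw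 σ a (u t) (θ t) N (Φ N) {z | δ < |Literature.MathematicalPhysics.KineticTheory.empiricalDensityField z χ - ∫ x, χ x * ρ t x|} ≤ ENNReal.ofReal (C * Real.exp (-(C⁻¹ * (N + 1)))) ∧ Literature.MathematicalPhysics.KineticTheory.localGibbsLaw σ a (u t) (θ t) N (Φ N) {z | δ < ‖Literature.MathematicalPhysics.KineticTheory.empiricalMomentumField z χ - ∫ x, (χ x * ρ t x) • u t x‖} ≤ ENNReal.ofReal (C * Real.exp (-(C⁻¹ * (N + 1)))) ∧ Literature.MathematicalPhysics.KineticTheory.localGibbsLaw σ a (u t) (θ t) N (Φ N) {z | δ < |Literature.MathematicalPhysics.KineticTheory.empiricalEnergyField z χ - ∫ x, χ x * Literature.MathematicalPhysics.KineticTheory.totalEnergyDensity (ρ t x) (u t x) (θ t x)|} ≤ ENNReal.ofReal (C * Real.exp (-(C⁻¹ * (N + 1))))) → ∃ C : ℝ, ∀ N : ℕ, |(InformationTheory.klDiv ((Φ N).lawAt (Literature.MathematicalPhysics.KineticTheory.localGibbsLaw σ a₀ u₀ θ₀ N (Φ N)) t) (Literature.MathematicalPhysics.KineticTheory.localGibbsLaw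 σ a (u t) (θ t) N (Φ N))).toReal / ((N : ℝ) + 1) - ((∫ z, (∫ y, Real.log (Literature.MathematicalPhysics.KineticTheory.localGibbsProfile a (u t) (θ t) y) ∂(Literature.Analysis.FluidPDE.empiricalMeasure z)) ∂(Literature.MathematicalPhysics.KineticTheory.localGibbsLaw σ a (u t) (θ t) N (Φ N))) - (∫ z, (∫ y, Real.log (Literature.MathematicalPhysics.KineticTheory.localGibbsProfile a (u t) (θ t) y) ∂(Literature.Analysis.FluidPDE.empiricalMeasure ((Φ N).flow t z))) ∂(Literature.MathematicalPhysics.KineticTheory.localGibbsLaw σ a₀ u₀ θ₀ N (Φ N))))| ≤ C * ((N : ℝ) + 1) ^ (-(1 / 3 : ℝ)))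

/-- item stmt-AtomisticToContinuum-5224 · support · rank 9 · closed · moot by None · by planner
sources: MeshalkinSinai1961, Spohn1991
[support] The Kolmogorov shear data of EhrenfestHorizon is an exact steady classical hard-sphere
Euler solution for every σ and every T: ρ ≡ 1, u(x) = A sin(4π x₁) e₀, θ ≡ θ₀ > 0 (div u = 0, (u·∇)u
= 0, p constant; smoothness of x ↦ sin(4π·repr(x)₁) on the torus). Grounds that the horizon data lie
inside the conjunct's hypothesis class with T = ∞. [difficulty: provable-now] -/
@[route_item "route-AtomisticToContinuum-KnudsenRate"]
def KolmogorovSteady : Prop :=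
  ∀ A θ₀ σ T : ℝ, 0 < θ₀ → Literature.MathematicalPhysics.KineticTheory.IsHardSphereEulerSolution σ T (fun _ _ => 1) (fun _ => (fun x : Literature.MathematicalPhysics.KineticTheory.T3 => (A * Real.sin (4 * Real.pi * (Literature.Analysis.FunctionSpaces.Torus.repr x) 1)) • EuclideanSpace.single (0 : Fin 3) (1 : ℝ))) (fun _ _ => θ₀)

/-- item stmt-AtomisticToContinuum-5225 · assembly · rank 1 · closed · moot by None · by planner
sources: OllaVaradhanYau1993, KipnisLandim1999, Yau1991
[assembly] EntropyKnudsenRate → HydrodynamicLimit (entropy inequality against the exponentially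
concentrating reference; pure measure theory given X). -/
@[route_item "route-AtomisticToContinuum-KnudsenRate"]
def Assembly : Prop :=
  EntropyKnudsenRate → Literature.MathematicalPhysics.KineticTheory.HydrodynamicLimit

end Summit.AtomisticToContinuum.HydrodynamicLimit.Theses.KnudsenRate
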